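import Summits.QuantumFields.YangMills.Theorems.BalabanUVNodesN15KingModelAnalyticDeterminantDecouplingTools
import Summits.QuantumFields.YangMills.Theorems.BalabanUVNodesN15KingModelAnalyticDeterminantVolumeLawFine
import Summits.QuantumFields.YangMills.Theorems.BalabanUVNodesN15KingModelComplexLinkBounds
import Summits.QuantumFields.YangMills.Theorems.BalabanUVNodesN15KingModelComplexLinkNumericalRange
import HarnessLib

/-!
# BalabanUVNodes ∕ N15 — THE KING-MODEL RUNG (PART Ϯ-l): DECOUPLING OF DISTANT BACKGROUND PERTURBATIONS — for the fine Gaussian normalisation `ln det(−cΔ_U + m²)` and two changes of a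
# real-orthogonal background `U₀` supported on DISJOINT bond sets `Z₁`, `Z₂` at torus distance `≥ D`, the CONNECTED second difference is exponentially small:
# `|ln det M(U₁₂) − ln det M(U₁) − ln det M(U₂) + ln det M(U₀)| ≤ 16c²|n|⁴·[(2∕m²)·C_per·e^{−κ_F D∕(d+1)}]²·#Z₁·#Z₂` (King's `A = 0` decay rate `κ_F = kappaFree c m² d` of PART Ε-d ∕ Ͱ-d) —
# the mixed second derivative `−tr(M⁻¹E₁M⁻¹E₂)` along the two-parameter CONTRACTION interpolation only sees the propagator BETWEEN the two supports
# (Track A, DAG node N15 = NE2; FAN-OUT v1.1 §N15 s3 «KING-MODEL RUNG … + what the curved case adds»; count-neutral)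

HONEST FRAMING.  Count-neutral (cell `pub-ymgap`, seat `pub-ymgap-dag-n15-e` g54; `--supports stmt-QuantumFields-27247 --as helper` = K3ᴬ, KEY MAP v3).  King's one-level comparison model: the
FINE covariant normalisation `det(−cΔ_U + m²)` (Ͱ-a `covLapF`) on one finite torus `Π_μℤ∕K_μ`, `𝕜 = ℝ` (real-orthogonal link fields; the interpolated fields are real contractions), `c ≥ 0`,
`m² > 0`, nonempty fibre.  The decay constants are the tree's `U ≡ 1` constants at `ε = 0` of PART Ϛ-d (`(2∕m²)·periodConst(κ_F)`, `κ_F = kappaFree c m² d`): HONESTLY NOT η-uniform at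
King's scaling `c = L²` (the prefactor `c∕m²` reappears; an η-uniform decay constant would need the sharp lattice Green's function decay, cf. Ϯ-e for the diagonal).  NOT the block-field
normalisation `Δ_eff` (its decoupling needs the decay of the FULL propagator with the block term — Ϧ's Combes–Thomas — successor door); NOT Bałaban's (3.42); NOT a node discharge; nothing
continuum ∕ ℝ⁴ ∕ OS ∕ Clay.

THE MECHANISM.  `W(s,t) = U₀ + s(U₁−U₀) + t(U₂−U₀)`, `s,t ∈ [0,1]`: on `Z₁` a convex combination of `U₀, U₁`, on `Z₂` of `U₀, U₂`, elsewhere `U₀` — CONTRACTIONS (§1), so `M(W) = −cΔ_W + m²`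
stays positive definite with the mass floor `m²` (Ϛ-c `re_quadForm_cxLapF_ge` at `ε = 0` through Ϛ-a `cxLapF_adjoint`) and its covariance has King's decay (Ϛ-d `norm_cxLapF_inv_entry_le_exp_tdistT`
at `ε = 0`); `M(W(s,t)) = M₀ + sE₁ + tE₂` is AFFINE (§2, `E_i = −T_{A_i,A_iᵀ}`, `A_i = U_i − U₀` supported on `Z_i`); `F(t) = ln det(M₀+E₁+tE₂) − ln det(M₀+tE₂)` has
`F′(t) = G_t(1) − G_t(0)`, `G_t(s) = tr((M₀+tE₂+sE₁)⁻¹E₂)` (Ϭ-l Jacobi), `G_t′(s) = −tr(X⁻¹E₁X⁻¹E₂)` (Ϯ-g Klingen), `|tr(X⁻¹E₁X⁻¹E₂)| ≤ b_X²‖E₁‖₁‖E₂‖₁` with `b_X` the CROSS-entry decay bound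
(Ϯ-k `abs_re_trace_mul4_le`), hence `|F(1) − F(0)| ≤ sup|F′| ≤ sup|G′|` (Ϯ-k `abs_sub_le_of_hasDerivAt_abs_le` twice).

PRIOR TREE ART (by name, not restated): Ϯ-k (tools), Ϯ-b `sum_norm_link_sub_le_of_eqOn`∕`sum_norm_conjTranspose_entry`, Ϯ-g `hasDerivAt_trace_inv_affine_mul`, Ϭ-l `hasDerivAt_log_det_affine`,
Ϛ-a `cxLapF`∕`cxHop`∕`cxLapF_adjoint`∕`cxHop_add`∕`cxHop_smul`, Ϛ-c `re_quadForm_cxLapF_ge`, Ϛ-d `norm_cxLapF_inv_entry_le_exp_tdistT`, Ͱ-a `isHermitian_covLapF`, Ͱ-l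
`l2_opNorm_of_mem_unitaryGroup_le`, Landau `posDef_of_coercive'`, `King1986.Torus.tdistT_symm`, Mathlib `Matrix.l2_opNorm_conjTranspose`.  Dedup (rg at filing): basename 0 files;
`norm_convexComb_unitary_le|posDef_covLapF_of_norm_le|norm_covLapF_inv_entry_le_exp_of_norm_le|covLapF_add_smul_add_smul|abs_log_det_covLapF_decoupling` 0 tree files.
Locators: [King1986] (2.13) p.653, (3.94)–(3.96) p.669, (4.4) p.670, (4.38) p.674; [Balaban1985BackgroundPropagators] (3.23) p.394, (3.42) p.397, §3.B p.399 l.37–40, Thm 3.4 p.400;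
[Klingen1990] Ch. V §11 (15) p.141.  0 `sorry`, 0 `def`.
-/

noncomputable section

open scoped BigOperators ComplexConjugate ComplexOrder Matrix.Norms.L2Operator
open Finset Matrix Set

namespace Summit.QuantumFields.YangMills.BalabanUVNodes.N15KingModelRung.Analytic

open Literature.MathematicalPhysics.QuantumFieldTheory.Balaban1983to89.B5Prop11Plancherel (Tor unitVec)
open Literature.MathematicalPhysics.QuantumFieldTheory.Balaban1983to89.B4TorusKernel (periodConst)
open Literature.MathematicalPhysics.QuantumFieldTheory.King1986.Torus (lapF tdistT tdistT_symm)
open Summit.QuantumFields.YangMills.BalabanUVNodes.N15KingModelRung.TorusSpectral (kappaFree kappaFree_pos)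
open Summit.QuantumFields.YangMills.BalabanUVNodes.N15KingModelRung.Covariant
  (covLapF isHermitian_covLapF cxLapF cxHop cxLapF_adjoint cxHop_add cxHop_smul re_quadForm_cxLapF_ge norm_cxLapF_inv_entry_le_exp_tdistT l2_opNorm_of_mem_unitaryGroup_le sum_norm_fib_sq)
open Summit.QuantumFields.YangMills.BalabanUVNodes.N15KingModelRung.Landau (posDef_of_coercive')

variable {d : ℕ} (K : Fin (d + 1) → ℕ) [hK : ∀ μ, NeZero (K μ)]

/-! ## §1 Contraction link fields: positivity and decay of the covariant covariance -/

section Contraction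

variable {𝕜 : Type*} [RCLike 𝕜] {n : Type*} [Fintype n] [DecidableEq n]

omit hK in
/-- A convex combination of two unitaries is a contraction: `‖V₀ + s(V₁ − V₀)‖ ≤ 1` for `s ∈ [0,1]`. [folklore] -/
theorem norm_convexComb_unitary_le {V₀ V₁ : Matrix n n 𝕜} (h₀ : V₀ ∈ Matrix.unitaryGroup n 𝕜) (h₁ : V₁ ∈ Matrix.unitaryGroup n 𝕜) {s : ℝ} (hs : s ∈ Icc (0 : ℝ) 1) :
    ‖V₀ + (s : 𝕜) • (V₁ - V₀)‖ ≤ 1 + 0 := by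
  obtain ⟨hs0, hs1⟩ := hs
  have e : V₀ + (s : 𝕜) • (V₁ - V₀) = ((1 - s : ℝ) : 𝕜) • V₀ + (s : 𝕜) • V₁ := by
    rw [smul_sub, RCLike.ofReal_sub, RCLike.ofReal_one, sub_smul, one_smul]; abel
  rw [e, add_zero]
  calc ‖((1 - s : ℝ) : 𝕜) • V₀ + (s : 𝕜) • V₁‖ ≤ ‖((1 - s : ℝ) : 𝕜) • V₀‖ + ‖(s : 𝕜) • V₁‖ := norm_add_le _ _
    _ ≤ (1 - s) * 1 + s * 1 := by
        rw [norm_smul, norm_smul, RCLike.norm_ofReal, RCLike.norm_ofReal, abs_of_nonneg (by linarith), abs_of_nonneg hs0]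
        exact add_le_add (mul_le_mul_of_nonneg_left (l2_opNorm_of_mem_unitaryGroup_le h₀) (by linarith))
          (mul_le_mul_of_nonneg_left (l2_opNorm_of_mem_unitaryGroup_le h₁) hs0)
    _ = 1 := by ring

variable {c m2 : ℝ} (hc : 0 ≤ c) (hm : 0 < m2)
include hc hm

/-- ★ THE COVARIANT OPERATOR OF A CONTRACTION FIELD IS POSITIVE DEFINITE with the mass floor `m²` (`‖W(b)‖ ≤ 1` for all `b`; Ϛ-c's coercivity at `ε = 0` through Ϛ-a `cxLapF_adjoint`).
[cite: Balaban1985BackgroundPropagators, Thm 3.4 p.400, (3.23) p.394; King1986, (4.4) p.670] -/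
theorem posDef_covLapF_of_norm_le {W : Tor K × Fin (d + 1) → Matrix n n 𝕜} (hW : ∀ b, ‖W b‖ ≤ 1 + 0) : (covLapF K c m2 W).PosDef := by
  have hW' : ∀ b, ‖(W b)ᴴ‖ ≤ 1 + 0 := fun b => by rw [Matrix.l2_opNorm_conjTranspose]; exact hW b
  refine posDef_of_coercive' K (isHermitian_covLapF K c m2 W) hm fun v => ?_
  have h := re_quadForm_cxLapF_ge K hc m2 hW hW' v
  rw [mul_zero, sub_zero, cxLapF_adjoint] at h
  rwa [sum_norm_fib_sq]

/-- ★ KING's DECAY FOR THE COVARIANCE OF A CONTRACTION FIELD: `‖(M_W⁻¹)_{(x,i),(y,j)}‖ ≤ (2∕m²)·C_per(κ_F)·e^{−κ_F·tdistT(x,y)∕(d+1)}`, `κ_F = kappaFree c m² d` (Ϛ-d at `ε = 0`).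
[cite: Balaban1985BackgroundPropagators, Thm 3.4 p.400, (3.42) p.397; King1986, (4.4) p.670, (4.38) p.674] -/
theorem norm_covLapF_inv_entry_le_exp_of_norm_le {W : Tor K × Fin (d + 1) → Matrix n n 𝕜} (hW : ∀ b, ‖W b‖ ≤ 1 + 0) (x y : Tor K) (i j : n) :
    ‖(covLapF K c m2 W)⁻¹ (x, i) (y, j)‖ ≤ 2 / m2 * periodConst (kappaFree c m2 d) d * Real.exp (-(kappaFree c m2 d / (d + 1) * tdistT K x y)) := by
  have hW' : ∀ b, ‖(W b)ᴴ‖ ≤ 1 + 0 := fun b => by rw [Matrix.l2_opNorm_conjTranspose]; exact hW b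
  have h := norm_cxLapF_inv_entry_le_exp_tdistT K hc hm le_rfl (by rw [mul_zero]; exact hm) hW hW' x y i j
  simp only [mul_zero, sub_zero, add_zero, one_mul] at h
  rwa [cxLapF_adjoint] at h

end Contraction

/-! ## §2 The two-parameter interpolation: contractions, affinity, supports -/

section Interpolation

variable {n : Type*} [Fintype n] [DecidableEq n]
variable {U₀ U₁ U₂ : Tor K × Fin (d + 1) → Matrix n n ℝ} (hU₀ : ∀ b, U₀ b ∈ Matrix.unitaryGroup n ℝ) (hU₁ : ∀ b, U₁ b ∈ Matrix.unitaryGroup n ℝ)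
  (hU₂ : ∀ b, U₂ b ∈ Matrix.unitaryGroup n ℝ)
variable {Z₁ Z₂ : Finset (Tor K × Fin (d + 1))} (h₁ : ∀ b, b ∉ Z₁ → U₁ b = U₀ b) (h₂ : ∀ b, b ∉ Z₂ → U₂ b = U₀ b) (hZ : Disjoint Z₁ Z₂)

omit hK in
include hU₀ hU₁ hU₂ h₁ h₂ hZ in
/-- ★ THE INTERPOLATED FIELDS ARE CONTRACTIONS: `‖U₀(b) + s(U₁(b)−U₀(b)) + t(U₂(b)−U₀(b))‖ ≤ 1` for `s,t ∈ [0,1]` (on `Z₁` the `t`-term vanishes, off `Z₁` the `s`-term; disjoint supports).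
[cite: Balaban1985BackgroundPropagators, §3.B p.399 l.37–40] -/
theorem norm_twoParam_le {s t : ℝ} (hs : s ∈ Icc (0 : ℝ) 1) (ht : t ∈ Icc (0 : ℝ) 1) (b : Tor K × Fin (d + 1)) :
    ‖(U₀ + (s : ℝ) • (U₁ - U₀) + (t : ℝ) • (U₂ - U₀)) b‖ ≤ 1 + 0 := by
  simp only [Pi.add_apply, Pi.smul_apply, Pi.sub_apply]
  by_cases hb : b ∈ Z₁
  · have hb2 : b ∉ Z₂ := Finset.disjoint_left.mp hZ hb
    rw [h₂ b hb2, sub_self, smul_zero, add_zero]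
    exact norm_convexComb_unitary_le (𝕜 := ℝ) (hU₀ b) (hU₁ b) hs
  · rw [h₁ b hb, sub_self, smul_zero, add_zero]
    exact norm_convexComb_unitary_le (𝕜 := ℝ) (hU₀ b) (hU₂ b) ht

omit [Fintype n] in
/-- ★ AFFINITY: `M(U₀ + sA + tB) = M(U₀) − s·T_{A,Aᵀ} − t·T_{B,Bᵀ}` for REAL link fields (the hopping matrix is ℝ-linear in the pair `(U, Uᵀ)`; Ϛ-a `cxHop_add`∕`cxHop_smul`).
[cite: Balaban1985BackgroundPropagators, (3.23) p.394; King1986, (4.4) p.670] -/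
theorem covLapF_add_smul_add_smul (c m2 : ℝ) (U₀ A B : Tor K × Fin (d + 1) → Matrix n n ℝ) (s t : ℝ) :
    covLapF K c m2 (U₀ + s • A + t • B)
      = covLapF K c m2 U₀ - s • cxHop K c A (fun b => (A b)ᴴ) - t • cxHop K c B (fun b => (B b)ᴴ) := by
  have hadj : (fun b => ((U₀ + s • A + t • B) b)ᴴ) = (fun b => (U₀ b)ᴴ) + s • (fun b => (A b)ᴴ) + t • (fun b => (B b)ᴴ) := by
    funext b
    simp
  rw [← cxLapF_adjoint K c m2 (U₀ + s • A + t • B), ← cxLapF_adjoint K c m2 U₀, hadj]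
  simp only [cxLapF]
  rw [cxHop_add, cxHop_add, cxHop_smul, cxHop_smul]
  abel

omit [Fintype n] in
/-- `M(U₁) − M(U₀) = −T_{A,Aᵀ}`, `A = U₁ − U₀`. [cite: Balaban1985BackgroundPropagators, (3.23) p.394] -/
theorem covLapF_sub_eq_neg_cxHop (c m2 : ℝ) (U₀ U₁ : Tor K × Fin (d + 1) → Matrix n n ℝ) :
    covLapF K c m2 U₁ - covLapF K c m2 U₀ = -cxHop K c (U₁ - U₀) (fun b => ((U₁ - U₀) b)ᴴ) := by
  have h := covLapF_add_smul_add_smul K c m2 U₀ (U₁ - U₀) (U₁ - U₀) 1 0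
  rw [one_smul, zero_smul, add_zero, add_sub_cancel, one_smul, zero_smul, sub_zero] at h
  rw [h]; abel

omit [Fintype n] [DecidableEq n] in
include h₁ in
/-- SUPPORT: the perturbation `T_{A,Aᵀ}`, `A = U₁ − U₀` (vanishing off `Z₁`), has nonzero entries only between endpoints of bonds of `Z₁` (Ϯ-k). [cite: King1986, (4.4) p.670] -/
theorem cxHop_sub_apply_ne_zero (c : ℝ) {p q : Tor K × n} (hne : cxHop K c (U₁ - U₀) (fun b => ((U₁ - U₀) b)ᴴ) p q ≠ 0) :
    (∃ b ∈ Z₁, p.1 = b.1 ∨ p.1 = b.1 + unitVec K b.2) ∧ (∃ b ∈ Z₁, q.1 = b.1 ∨ q.1 = b.1 + unitVec K b.2) := by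
  have hA : ∀ b, b ∉ Z₁ → (U₁ - U₀) b = 0 := fun b hb => by rw [Pi.sub_apply, h₁ b hb, sub_self]
  have hB : ∀ b, b ∉ Z₁ → (fun b => ((U₁ - U₀) b)ᴴ) b = 0 := fun b hb => by simp only [hA b hb, Matrix.conjTranspose_zero]
  constructor
  · by_contra hcon
    push Not at hcon
    exact hne (cxHop_apply_eq_zero_of_fst K c hA hB (fun b hb => hcon b hb) q)
  · by_contra hcon
    push Not at hcon
    exact hne (cxHop_apply_eq_zero_of_snd K c hA hB p (fun b hb => hcon b hb))

include hU₀ hU₁ h₁ in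
/-- ℓ¹ SIZE: `Σ‖(T_{A,Aᵀ})_{pq}‖ ≤ 4c|n|²·#Z₁` (Ϯ-k `sum_norm_cxHop_entry_le`, Ϯ-b `sum_norm_link_sub_le_of_eqOn`). [cite: King1986, (1.2)–(1.3) p.650, (4.4) p.670] -/
theorem sum_norm_cxHop_sub_le {c : ℝ} (hc : 0 ≤ c) :
    ∑ p : Tor K × n, ∑ q : Tor K × n, ‖cxHop K c (U₁ - U₀) (fun b => ((U₁ - U₀) b)ᴴ) p q‖ ≤ 4 * c * (Fintype.card n : ℝ) ^ 2 * Z₁.card := by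
  have h := sum_norm_cxHop_entry_le K hc (U₁ - U₀) (fun b => ((U₁ - U₀) b)ᴴ)
  have hl1 := sum_norm_link_sub_le_of_eqOn K hU₁ hU₀ (Z := Z₁) h₁
  refine h.trans ?_
  have e1 : ∀ b, (∑ i, ∑ j, ‖(fun b => ((U₁ - U₀) b)ᴴ) b i j‖) = ∑ i, ∑ j, ‖U₁ b i j - U₀ b i j‖ := fun b => by
    rw [show (fun b => ((U₁ - U₀) b)ᴴ) b = ((U₁ - U₀) b)ᴴ from rfl, sum_norm_conjTranspose_entry]; rfl
  have e2 : ∀ b, (∑ i, ∑ j, ‖(U₁ - U₀) b i j‖) = ∑ i, ∑ j, ‖U₁ b i j - U₀ b i j‖ := fun b => rfl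
  simp only [e1, e2]
  rw [Finset.sum_add_distrib, ← two_mul]
  nlinarith [hl1, hc]

end Interpolation

/-! ## §3 The decoupling theorem -/

section Decoupling

variable {n : Type*} [Fintype n] [DecidableEq n] [Nonempty n]
variable {c m2 : ℝ} (hc : 0 ≤ c) (hm : 0 < m2)
variable {U₀ U₁ U₂ : Tor K × Fin (d + 1) → Matrix n n ℝ} (hU₀ : ∀ b, U₀ b ∈ Matrix.unitaryGroup n ℝ) (hU₁ : ∀ b, U₁ b ∈ Matrix.unitaryGroup n ℝ)
  (hU₂ : ∀ b, U₂ b ∈ Matrix.unitaryGroup n ℝ)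
variable {Z₁ Z₂ : Finset (Tor K × Fin (d + 1))} (h₁ : ∀ b, b ∉ Z₁ → U₁ b = U₀ b) (h₂ : ∀ b, b ∉ Z₂ → U₂ b = U₀ b) (hZ : Disjoint Z₁ Z₂)
variable {D : ℝ} (hsep : ∀ x y : Tor K, (∃ b ∈ Z₁, x = b.1 ∨ x = b.1 + unitVec K b.2) → (∃ b ∈ Z₂, y = b.1 ∨ y = b.1 + unitVec K b.2) → D ≤ tdistT K x y)
include hc hm hU₀ hU₁ hU₂ h₁ h₂ hZ hsep

/-- ★★★★ **DECOUPLING OF DISTANT BACKGROUND PERTURBATIONS FOR THE FINE GAUSSIAN NORMALISATION**: two changes of a real-orthogonal background `U₀` supported on disjoint bond sets `Z₁`, `Z₂`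
whose endpoints are at torus distance `≥ D` have an exponentially small CONNECTED effect on `ln det(−cΔ_U + m²)`:
`|ln det M(U₁+U₂−U₀) − ln det M(U₁) − ln det M(U₂) + ln det M(U₀)| ≤ 16c²|n|⁴·[(2∕m²)·C_per(κ_F)·e^{−κ_F D∕(d+1)}]²·#Z₁·#Z₂` with King's `A = 0` rate `κ_F = kappaFree c m² d` —
the cluster property behind every polymer expansion in the background, for King's comparison model. [cite: King1986, (2.13) p.653, (3.94)–(3.96) p.669, (4.4) p.670, (4.38) p.674;
Balaban1985BackgroundPropagators, (3.23) p.394, (3.42) p.397, Thm 3.4 p.400; Klingen1990, Ch. V §11 (15) p.141] -/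
theorem abs_log_det_covLapF_decoupling :
    |Real.log (covLapF K c m2 (U₁ + U₂ - U₀)).det - Real.log (covLapF K c m2 U₁).det - Real.log (covLapF K c m2 U₂).det + Real.log (covLapF K c m2 U₀).det|
      ≤ 16 * c ^ 2 * (Fintype.card n : ℝ) ^ 4
          * (2 / m2 * periodConst (kappaFree c m2 d) d * Real.exp (-(kappaFree c m2 d / (d + 1) * D))) ^ 2 * Z₁.card * Z₂.card := by
  -- the data
  set M₀ := covLapF K c m2 U₀ with hM₀
  set E₁ := -cxHop K c (U₁ - U₀) (fun b => ((U₁ - U₀) b)ᴴ) with hE₁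
  set E₂ := -cxHop K c (U₂ - U₀) (fun b => ((U₂ - U₀) b)ᴴ) with hE₂
  set bX : ℝ := 2 / m2 * periodConst (kappaFree c m2 d) d * Real.exp (-(kappaFree c m2 d / (d + 1) * D)) with hbX
  set ℓ₁ : ℝ := ∑ p : Tor K × n, ∑ q : Tor K × n, ‖E₁ p q‖ with hℓ₁
  set ℓ₂ : ℝ := ∑ p : Tor K × n, ∑ q : Tor K × n, ‖E₂ p q‖ with hℓ₂
  set B : ℝ := bX * bX * ℓ₁ * ℓ₂ with hB
  -- affinity of the two-parameter family
  have haff : ∀ s t : ℝ, covLapF K c m2 (U₀ + s • (U₁ - U₀) + t • (U₂ - U₀)) = M₀ + s • E₁ + t • E₂ := by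
    intro s t
    rw [covLapF_add_smul_add_smul, hM₀, hE₁, hE₂, smul_neg, smul_neg]; abel
  -- positivity and decay along the family
  have hcontr : ∀ {s t : ℝ}, s ∈ Icc (0 : ℝ) 1 → t ∈ Icc (0 : ℝ) 1 → ∀ b, ‖(U₀ + s • (U₁ - U₀) + t • (U₂ - U₀)) b‖ ≤ 1 + 0 :=
    fun hs ht b => norm_twoParam_le K hU₀ hU₁ hU₂ h₁ h₂ hZ hs ht b
  have hpd : ∀ {s t : ℝ}, s ∈ Icc (0 : ℝ) 1 → t ∈ Icc (0 : ℝ) 1 → (M₀ + s • E₁ + t • E₂).PosDef := fun hs ht => by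
    rw [← haff]; exact posDef_covLapF_of_norm_le K hc hm (hcontr hs ht)
  have hdet : ∀ {s t : ℝ}, s ∈ Icc (0 : ℝ) 1 → t ∈ Icc (0 : ℝ) 1 → (M₀ + s • E₁ + t • E₂).det ≠ 0 := fun hs ht => (hpd hs ht).det_pos.ne'
  -- nonnegativity of the cross bound
  have hbX0 : 0 ≤ bX := by
    have := norm_covLapF_inv_entry_le_exp_of_norm_le K hc hm (hcontr (left_mem_Icc.mpr zero_le_one) (left_mem_Icc.mpr zero_le_one))
      (Classical.arbitrary (Tor K)) (Classical.arbitrary (Tor K)) (Classical.arbitrary n) (Classical.arbitrary n)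
    have h0 := (norm_nonneg _).trans this
    have hκ := (kappaFree_pos hc hm d).le
    have hexp : Real.exp (-(kappaFree c m2 d / (d + 1) * tdistT K (Classical.arbitrary (Tor K)) (Classical.arbitrary (Tor K)))) ≤ 1 := by
      rw [Real.exp_le_one_iff, neg_nonpos]
      exact mul_nonneg (div_nonneg hκ (by positivity)) (Literature.MathematicalPhysics.QuantumFieldTheory.King1986.Torus.tdistT_nonneg K _ _)
    have hpre : 0 ≤ 2 / m2 * periodConst (kappaFree c m2 d) d := by
      by_contra hneg
      push Not at hneg
      have : 2 / m2 * periodConst (kappaFree c m2 d) d * Real.exp (-(kappaFree c m2 d / (d + 1) * tdistT K (Classical.arbitrary (Tor K)) (Classical.arbitrary (Tor K)))) < 0 :=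
        mul_neg_of_neg_of_pos hneg (Real.exp_pos _)
      linarith
    exact mul_nonneg hpre (Real.exp_pos _).le
  -- the cross entries of the interpolated covariance are below `bX`
  have hcross : ∀ {s t : ℝ}, s ∈ Icc (0 : ℝ) 1 → t ∈ Icc (0 : ℝ) 1 → ∀ α β : Tor K × n,
      ((∃ b ∈ Z₁, α.1 = b.1 ∨ α.1 = b.1 + unitVec K b.2) ∧ (∃ b ∈ Z₂, β.1 = b.1 ∨ β.1 = b.1 + unitVec K b.2)
        ∨ (∃ b ∈ Z₂, α.1 = b.1 ∨ α.1 = b.1 + unitVec K b.2) ∧ (∃ b ∈ Z₁, β.1 = b.1 ∨ β.1 = b.1 + unitVec K b.2)) →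
      ‖(M₀ + s • E₁ + t • E₂)⁻¹ α β‖ ≤ bX := by
    intro s t hs ht α β hαβ
    obtain ⟨x, i⟩ := α
    obtain ⟨y, j⟩ := β
    have h := norm_covLapF_inv_entry_le_exp_of_norm_le K hc hm (hcontr hs ht) x y i j
    rw [haff] at h
    refine h.trans (mul_le_mul_of_nonneg_left ?_ ?_)
    · apply Real.exp_le_exp.mpr
      have hκ : 0 ≤ kappaFree c m2 d / (d + 1) := div_nonneg (kappaFree_pos hc hm d).le (by positivity)
      have hD : D ≤ tdistT K x y := by
        rcases hαβ with ⟨hx, hy⟩ | ⟨hx, hy⟩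
        · exact hsep x y hx hy
        · rw [tdistT_symm]; exact hsep y x hy hx
      nlinarith
    · by_contra hneg
      push Not at hneg
      have : bX < 0 := by rw [hbX]; exact mul_neg_of_neg_of_pos hneg (Real.exp_pos _)
      linarith
  -- the supports of the perturbations
  have hsuppE₁ : ∀ β γ : Tor K × n, E₁ β γ ≠ 0 → (∃ b ∈ Z₁, β.1 = b.1 ∨ β.1 = b.1 + unitVec K b.2) ∧ (∃ b ∈ Z₁, γ.1 = b.1 ∨ γ.1 = b.1 + unitVec K b.2) :=
    fun β γ hne => cxHop_sub_apply_ne_zero K h₁ c (by rwa [hE₁, Matrix.neg_apply, neg_ne_zero] at hne)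
  have hsuppE₂ : ∀ δ α : Tor K × n, E₂ δ α ≠ 0 → (∃ b ∈ Z₂, δ.1 = b.1 ∨ δ.1 = b.1 + unitVec K b.2) ∧ (∃ b ∈ Z₂, α.1 = b.1 ∨ α.1 = b.1 + unitVec K b.2) :=
    fun δ α hne => cxHop_sub_apply_ne_zero K h₂ c (by rwa [hE₂, Matrix.neg_apply, neg_ne_zero] at hne)
  -- the mixed second derivative is bounded by `B`
  have hmixed : ∀ {s t : ℝ}, s ∈ Icc (0 : ℝ) 1 → t ∈ Icc (0 : ℝ) 1 →
      |((M₀ + s • E₁ + t • E₂)⁻¹ * E₁ * (M₀ + s • E₁ + t • E₂)⁻¹ * E₂).trace| ≤ B := by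
    intro s t hs ht
    have h := abs_re_trace_mul4_le (𝕜 := ℝ) (P := (M₀ + s • E₁ + t • E₂)⁻¹) (Q := (M₀ + s • E₁ + t • E₂)⁻¹) (E₁ := E₁) (E₂ := E₂)
      (T₁ := fun p : Tor K × n => ∃ b ∈ Z₁, p.1 = b.1 ∨ p.1 = b.1 + unitVec K b.2) (T₂ := fun p : Tor K × n => ∃ b ∈ Z₂, p.1 = b.1 ∨ p.1 = b.1 + unitVec K b.2)
      hbX0 hsuppE₁ hsuppE₂ (fun α β hα hβ => hcross hs ht α β (Or.inr ⟨hα, hβ⟩)) (fun γ δ hγ hδ => hcross hs ht γ δ (Or.inl ⟨hγ, hδ⟩))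
    simp only [RCLike.re_to_real] at h
    rw [hB]; linarith [h]
  -- `G_t(s) = tr((M₀ + tE₂ + sE₁)⁻¹E₂)`: `|G_t(1) − G_t(0)| ≤ B`
  have hG : ∀ {t : ℝ}, t ∈ Icc (0 : ℝ) 1 → |((M₀ + t • E₂ + (1 : ℝ) • E₁)⁻¹ * E₂).trace - ((M₀ + t • E₂ + (0 : ℝ) • E₁)⁻¹ * E₂).trace| ≤ B := by
    intro t ht
    refine abs_sub_le_of_hasDerivAt_abs_le (ψ := fun s => ((M₀ + t • E₂ + s • E₁)⁻¹ * E₂).trace)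
      (ψ' := fun s => -((M₀ + t • E₂ + s • E₁)⁻¹ * E₁ * (M₀ + t • E₂ + s • E₁)⁻¹ * E₂).trace) (fun s hs => ?_) (fun s hs => ?_)
    · have hd : (M₀ + t • E₂ + s • E₁).det ≠ 0 := by rw [add_right_comm]; exact hdet hs ht
      exact hasDerivAt_trace_inv_affine_mul (M₀ + t • E₂) E₁ E₂ hd
    · rw [abs_neg, add_right_comm]
      exact hmixed hs ht
  -- `F(t) = ln det(M₀ + E₁ + tE₂) − ln det(M₀ + tE₂)`: `|F′| ≤ B`, hence `|F(1) − F(0)| ≤ B`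
  have hF := abs_sub_le_of_hasDerivAt_abs_le (B := B) (ψ := fun t => Real.log (M₀ + E₁ + t • E₂).det - Real.log (M₀ + t • E₂).det)
    (ψ' := fun t => ((M₀ + E₁ + t • E₂)⁻¹ * E₂).trace - ((M₀ + t • E₂)⁻¹ * E₂).trace)
    (fun t ht => by
      have hd1 : (M₀ + E₁ + t • E₂).det ≠ 0 := by
        have := hdet (right_mem_Icc.mpr zero_le_one) ht; rwa [one_smul] at this
      have hd0 : (M₀ + t • E₂).det ≠ 0 := by
        have := hdet (left_mem_Icc.mpr zero_le_one) ht; rwa [zero_smul, add_zero] at this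
      exact (hasDerivAt_log_det_affine (M₀ + E₁) E₂ hd1).sub (hasDerivAt_log_det_affine M₀ E₂ hd0))
    (fun t ht => by
      have h := hG ht
      rw [one_smul, zero_smul, add_zero, add_right_comm] at h
      exact h)
  -- identify the four determinants
  have hW11 : U₀ + (1 : ℝ) • (U₁ - U₀) + (1 : ℝ) • (U₂ - U₀) = U₁ + U₂ - U₀ := by
    rw [one_smul, one_smul]; abel
  have hW10 : U₀ + (1 : ℝ) • (U₁ - U₀) + (0 : ℝ) • (U₂ - U₀) = U₁ := by
    rw [one_smul, zero_smul, add_zero]; abel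
  have hW01 : U₀ + (0 : ℝ) • (U₁ - U₀) + (1 : ℝ) • (U₂ - U₀) = U₂ := by
    rw [one_smul, zero_smul, add_zero]; abel
  have e12 : M₀ + E₁ + (1 : ℝ) • E₂ = covLapF K c m2 (U₁ + U₂ - U₀) := by
    have h := haff 1 1
    rw [hW11] at h
    rw [h, one_smul, one_smul]
  have e1 : M₀ + E₁ + (0 : ℝ) • E₂ = covLapF K c m2 U₁ := by
    have h := haff 1 0
    rw [hW10] at h
    rw [h, one_smul, zero_smul, add_zero]
  have e2 : M₀ + (1 : ℝ) • E₂ = covLapF K c m2 U₂ := by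
    have h := haff 0 1
    rw [hW01] at h
    rw [h, one_smul, zero_smul, add_zero]
  have e0 : M₀ + (0 : ℝ) • E₂ = covLapF K c m2 U₀ := by rw [zero_smul, add_zero]
  simp only [e12, e1, e2, e0] at hF
  -- the size of `B`
  have hℓ₁ : ℓ₁ ≤ 4 * c * (Fintype.card n : ℝ) ^ 2 * Z₁.card := by
    have h := sum_norm_cxHop_sub_le K hU₀ hU₁ h₁ hc
    rw [hℓ₁, hE₁]; simpa only [Matrix.neg_apply, norm_neg] using h
  have hℓ₂ : ℓ₂ ≤ 4 * c * (Fintype.card n : ℝ) ^ 2 * Z₂.card := by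
    have h := sum_norm_cxHop_sub_le K hU₀ hU₂ h₂ hc
    rw [hℓ₂, hE₂]; simpa only [Matrix.neg_apply, norm_neg] using h
  have hℓ₁0 : 0 ≤ ℓ₁ := Finset.sum_nonneg fun _ _ => Finset.sum_nonneg fun _ _ => norm_nonneg _
  have hℓ₂0 : 0 ≤ ℓ₂ := Finset.sum_nonneg fun _ _ => Finset.sum_nonneg fun _ _ => norm_nonneg _
  have hBle : B ≤ 16 * c ^ 2 * (Fintype.card n : ℝ) ^ 4 * bX ^ 2 * Z₁.card * Z₂.card := by
    rw [hB]
    calc bX * bX * ℓ₁ * ℓ₂ ≤ bX * bX * (4 * c * (Fintype.card n : ℝ) ^ 2 * Z₁.card) * (4 * c * (Fintype.card n : ℝ) ^ 2 * Z₂.card) :=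
          mul_le_mul (mul_le_mul_of_nonneg_left hℓ₁ (mul_nonneg hbX0 hbX0)) hℓ₂ hℓ₂0 (by positivity)
      _ = 16 * c ^ 2 * (Fintype.card n : ℝ) ^ 4 * bX ^ 2 * Z₁.card * Z₂.card := by ring
  have efin : Real.log (covLapF K c m2 (U₁ + U₂ - U₀)).det - Real.log (covLapF K c m2 U₁).det - Real.log (covLapF K c m2 U₂).det + Real.log (covLapF K c m2 U₀).det
      = (Real.log (covLapF K c m2 (U₁ + U₂ - U₀)).det - Real.log (covLapF K c m2 U₂).det) - (Real.log (covLapF K c m2 U₁).det - Real.log (covLapF K c m2 U₀).det) := by ring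
  rw [efin]
  exact hF.trans hBle

end Decoupling

end Summit.QuantumFields.YangMills.BalabanUVNodes.N15KingModelRung.Analytic

end
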